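import Summits.Ventures.Crystal3D.Theorems.StickyWulffConstantGenericWallFloorSampleDeficitUpper
import Summits.Ventures.Crystal3D.Theorems.StickyWulffConstantGenericWallFloorSlotGeometry
import Summits.Ventures.Crystal3D.Theorems.StickyWulffConstantCoaxialWallLawFrame
import Summits.Ventures.Crystal3D.Theorems.StickyWulffConstantNoReconstructionGainSymmetry
import HarnessLib

/-!
# Mixed-dozen rules: the combinatorial consequences of the blocking lemma used by the rigid rung

HONEST FRAMING. Part of the venture `Summits/Ventures/Crystal3D` (cell `crystal3d-full`), helper for the
crux `GenericWallFloor` (stmt-Ventures-19480) of `route-Ventures-StickyWulffConstant`, line `WallLedgerG`,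
rigid-bicrystal rung of `stub_twoSlabAdhesion` (notes RIGID-RUNG-ARCH / M7-CERT / M5-CERT on the item).
Rung credit only; nothing here is the crux.

The certified computations M7 (coincidence top sites) and M5 (non-coincidence top sites) prune with
four EXACT rules, all consequences (closure of `Λ₀` under `±` is reused from
`fcc_add_site_mem` / `fcc_neg_mem`) of the landed blocking lemma `exists_two_adjacent_slots_near`
(a unit vector that is not a lattice vector is strictly within distance 1 of two ADJACENT slots).  This
file states them in the tree's vocabulary so that a Lean port of the certificates (or a structural proof)
can cite them:

* `exists_two_adjacent_empty_slots` (Rule A at the origin): a unit `d ∉ Λ₀` at distance `≥ 1` from a set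
  `O` of occupied slots leaves two ADJACENT slots outside `O`;
* `false_of_foreign_of_eleven_slots` (Rule E11): no foreign unit vector is compatible with eleven slots;
* `neg_mem_fccSlots` (used by Rule E2: the slot set is centrally symmetric);
* `exists_two_adjacent_empty_slots_at_site` (Rule A at a site of a moved lattice `A·Λ₀ + t` inside a
  `1`-separated configuration `X`): a neighbour `q ∈ X` of `p` that is NOT a lattice point forces two
  adjacent EMPTY slots `p + A w₁, p + A w₂ ∉ X`.
-/

noncomputable section

namespace Summit.Ventures.Crystal3D.Theorems

open Summit.Ventures.Crystal3D Finset
open Literature.MathematicalPhysics.StatisticalMechanics (barlowPos fccStacking constHagg)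
open scoped InnerProductSpace

/-- A unit lattice vector is a slot (membership form of `setOf_unit_fcc_eq_fccSlots`). -/
theorem mem_fccSlots_of_unit {w : EuclideanSpace ℝ (Fin 3)}
    (hw : w ∈ fccStacking 1 (Real.sqrt (2 / 3))) (hn : ‖w‖ = 1) : w ∈ fccSlots := by
  have h : w ∈ {w ∈ fccStacking 1 (Real.sqrt (2 / 3)) | ‖w‖ = 1} := ⟨hw, hn⟩
  rw [setOf_unit_fcc_eq_fccSlots] at h
  exact Finset.mem_coe.1 h

/-- **The slot set is centrally symmetric** (Rule E2 of M7-CERT uses: `u ∈ slots ⇔ −u ∈ slots`). -/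
theorem neg_mem_fccSlots {w : EuclideanSpace ℝ (Fin 3)} (hw : w ∈ fccSlots) : -w ∈ fccSlots :=
  mem_fccSlots_of_unit (fcc_neg_mem (mem_fcc_of_mem_fccSlots hw))
    (by rw [norm_neg, norm_eq_one_of_mem_fccSlots hw])

/-- **Rule A (at the origin).**  A unit vector `d` that is not a lattice vector and is at distance `≥ 1`
from every slot of a set `O` (`⟪w, d⟫ ≤ ½`) leaves two ADJACENT slots outside `O`. -/
theorem exists_two_adjacent_empty_slots (d : EuclideanSpace ℝ (Fin 3)) (hd : ‖d‖ = 1)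
    (hns : d ∉ fccStacking 1 (Real.sqrt (2 / 3))) (O : Finset (EuclideanSpace ℝ (Fin 3)))
    (hO : ∀ w ∈ O, ⟪w, d⟫_ℝ ≤ 1 / 2) :
    ∃ w₁ ∈ fccSlots, ∃ w₂ ∈ fccSlots,
      w₁ ∉ O ∧ w₂ ∉ O ∧ w₁ ≠ w₂ ∧ ⟪w₁, w₂⟫_ℝ = 1 / 2 ∧ 1 / 2 < ⟪w₁, d⟫_ℝ ∧ 1 / 2 < ⟪w₂, d⟫_ℝ := by
  obtain ⟨w₁, hw₁, w₂, hw₂, hn₁, hn₂, h12, hd₁, hd₂⟩ := exists_two_adjacent_slots_near d hd hns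
  refine ⟨w₁, mem_fccSlots_of_unit hw₁ hn₁, w₂, mem_fccSlots_of_unit hw₂ hn₂, ?_, ?_, ?_, h12, hd₁, hd₂⟩
  · intro h; have := hO w₁ h; linarith
  · intro h; have := hO w₂ h; linarith
  · intro h
    subst h
    have : ⟪w₁, w₁⟫_ℝ = 1 := by rw [real_inner_self_eq_norm_sq, hn₁, one_pow]
    linarith

/-- **Rule E11.**  No unit vector outside the lattice is compatible (`⟪w, d⟫ ≤ ½`, i.e. at distance `≥ 1`)
with all slots but one: an `11 + 1` kissing dozen (eleven own neighbours and one foreign one) does not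
exist. -/
theorem false_of_foreign_of_eleven_slots (d u₀ : EuclideanSpace ℝ (Fin 3)) (hd : ‖d‖ = 1)
    (hns : d ∉ fccStacking 1 (Real.sqrt (2 / 3)))
    (hO : ∀ w ∈ fccSlots, w ≠ u₀ → ⟪w, d⟫_ℝ ≤ 1 / 2) : False := by
  classical
  obtain ⟨w₁, hw₁, w₂, hw₂, ho₁, ho₂, hne, -, -, -⟩ :=
    exists_two_adjacent_empty_slots d hd hns (fccSlots.erase u₀)
      (fun w hw => hO w (Finset.mem_of_mem_erase hw) (Finset.ne_of_mem_erase hw))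
  have h₁ : w₁ = u₀ := by
    by_contra h; exact ho₁ (Finset.mem_erase.2 ⟨h, hw₁⟩)
  have h₂ : w₂ = u₀ := by
    by_contra h; exact ho₂ (Finset.mem_erase.2 ⟨h, hw₂⟩)
  exact hne (h₁.trans h₂.symm)

/-- **Rule A at a site of a moved lattice.**  Let `p ∈ A·Λ₀ + t`, let `X` be `1`-separated, and let
`q ∈ X` be a neighbour of `p` (`dist p q = 1`) which is NOT a point of `A·Λ₀ + t` (a "foreign" ball).  Then
two ADJACENT slots of `p` are empty: `p + A w₁ ∉ X`, `p + A w₂ ∉ X` with `⟪w₁, w₂⟫ = ½` (indeed the foreign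
ball is strictly within distance `1` of both slot positions, which are lattice points, hence `≠ q`). -/
theorem exists_two_adjacent_empty_slots_at_site
    (A : EuclideanSpace ℝ (Fin 3) ≃ₗᵢ[ℝ] EuclideanSpace ℝ (Fin 3)) (t p q : EuclideanSpace ℝ (Fin 3))
    (X : Finset (EuclideanSpace ℝ (Fin 3)))
    (hp : p ∈ (fun x => A x + t) '' fccStacking 1 (Real.sqrt (2 / 3)))
    (hq : q ∉ (fun x => A x + t) '' fccStacking 1 (Real.sqrt (2 / 3)))
    (hpq : dist p q = 1) (hqX : q ∈ X)
    (hsep : ∀ x ∈ X, ∀ y ∈ X, x ≠ y → 1 ≤ dist x y) :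
    ∃ w₁ ∈ fccSlots, ∃ w₂ ∈ fccSlots, w₁ ≠ w₂ ∧ ⟪w₁, w₂⟫_ℝ = 1 / 2 ∧
      dist (p + A w₁) q < 1 ∧ dist (p + A w₂) q < 1 ∧ p + A w₁ ∉ X ∧ p + A w₂ ∉ X := by
  obtain ⟨p₀, hp₀, hp₀e⟩ := hp
  simp only at hp₀e
  set d : EuclideanSpace ℝ (Fin 3) := A.symm (q - p) with hd_def
  have hAd : A d = q - p := by rw [hd_def, LinearIsometryEquiv.apply_symm_apply]
  have hd : ‖d‖ = 1 := by
    rw [hd_def, LinearIsometryEquiv.norm_map, ← dist_eq_norm, dist_comm, hpq]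
  -- lattice positions around `p`
  have hpos : ∀ w ∈ fccStacking 1 (Real.sqrt (2 / 3)),
      p + A w ∈ (fun x => A x + t) '' fccStacking 1 (Real.sqrt (2 / 3)) := by
    intro w hw
    refine ⟨p₀ + w, fcc_add_site_mem hp₀ hw, ?_⟩
    simp only [map_add]; rw [← hp₀e]; abel
  have hns : d ∉ fccStacking 1 (Real.sqrt (2 / 3)) := by
    intro h
    apply hq
    have := hpos d h
    rwa [hAd, add_sub_cancel] at this
  obtain ⟨w₁, hw₁, w₂, hw₂, -, -, hne, h12, hd₁, hd₂⟩ :=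
    exists_two_adjacent_empty_slots d hd hns ∅ (by simp)
  -- distance from a slot position to the foreign ball
  have hdist : ∀ w ∈ fccSlots, 1 / 2 < ⟪w, d⟫_ℝ → dist (p + A w) q < 1 := by
    intro w hw hwd
    have hnw : ‖w‖ = 1 := norm_eq_one_of_mem_fccSlots hw
    have h1 : dist (p + A w) q = ‖w - d‖ := by
      rw [dist_eq_norm, show p + A w - q = A w - (q - p) by abel, ← hAd, ← map_sub,
        LinearIsometryEquiv.norm_map]
    have h2 : ‖w - d‖ ^ 2 < 1 := by
      rw [@norm_sub_sq_real, hnw, hd]; linarith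
    rw [h1]
    nlinarith [norm_nonneg (w - d)]
  have hnot : ∀ w ∈ fccSlots, 1 / 2 < ⟪w, d⟫_ℝ → p + A w ∉ X := by
    intro w hw hwd hX
    have hlt := hdist w hw hwd
    have hne' : p + A w ≠ q := by
      intro h
      exact hq (h ▸ hpos w (mem_fcc_of_mem_fccSlots hw))
    have := hsep _ hX _ hqX hne'
    linarith
  exact ⟨w₁, hw₁, w₂, hw₂, hne, h12, hdist w₁ hw₁ hd₁, hdist w₂ hw₂ hd₂,
    hnot w₁ hw₁ hd₁, hnot w₂ hw₂ hd₂⟩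

end Summit.Ventures.Crystal3D.Theorems

end
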